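import Literature.AlgebraicGeometry.AbelianSchemes.AbelianSchemeHomReductionSpecialFibreKernel   -- ★ (ν8k) ED. 2 `exists_specialFibre_hom_reduction_ker_ringAction`
import Literature.AlgebraicGeometry.AbelianSchemes.SerreTensorRecognitionOfPoints                -- ★ KER-EQ `exists_iso_serreTranslate_comp_eq_equivariant_of_comp_eq_one_iff_forall_mem`
import Literature.AlgebraicGeometry.AbelianSchemes.CoverFiniteFlatOfSerrePresentation            -- ★ `isFinite_left_of_serrePresentation`
import Literature.AlgebraicGeometry.AbelianSchemes.CoverSurjectiveOfSerrePresentation            -- ★ `surjective_left_of_serrePresentation`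
import Literature.NumberTheory.NumberFields.SerreTensorPresentationOfIdeal                       -- ★ `exists_serrePresentation_of_ideal`
import HarnessLib

/-!
# The fibre-level Serre recognition package of the special fibres from a generic Serre cover
# (`A_{x̄″} ≅ A_{x̄} ⊗_𝒪 𝔞⁻¹` downstairs from `c : A_x → A_{x″}` with `Ker c = A_x[𝔞]` upstairs; [SerreTate1968] §1, [Conrad2004GrossZagier] §7 Thm. 7.5)

Topic `AlgebraicGeometry/AbelianSchemes`, namespace `Literature.AlgebraicGeometry.AbelianSchemes.AbelianSchemeOver`.  THEOREMS ONLY (no definition, no named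
fact, no `instance`, no notation, no `sorry`).  Cell `hodgecm-mathlib` (D-0151), F0∕P6 «MOD», «GO 500» line L2 (socket `stub_DOWN` of the D-line
`Cruxes/HLiu418/Lines/F0_P6a_DatumOfInputs.lean`), organ `stub_LAYERISO`, piece (HREC) = THE PROVIDER of the fibre-level recognition package `hrec` consumed by the
L2 head `layerIso_on_sheet_of_fibreRecognition` (HOME `F0/P6/L2/LA2-p03/g0/StubLAYERISO.fold.v4…`) through ★ (R9′) `exists_layerIso_of_fibreRecognition_of_rank`.
`--supports stmt-HodgeConjecture-24832`, count-neutral.  HONEST LABEL: HC_CM is proved only modulo the cell's 2 remaining named inputs (hLiu418 24832, h413 24833)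
until rung 0 closes; this file discharges none of them.

## Mathematics

`𝓨` a proper model at the place `v` of the number field `K`, `𝒜 → 𝓨` an abelian scheme with commutative group law and an action `ι` of the ring of integers `𝒪 = 𝓞 F` of a
number field `F`, `𝔞 ⊆ 𝒪` a NONZERO ideal, `x, x″ ∈ Y(Ω̄)` two geometric points of the generic fibre with reductions `x̄ = red x`, `x̄″ = red x″ ∈ 𝓨_s(κ̄)`.  UPSTAIRS: a
homomorphism `c : 𝒜_x → 𝒜_{x″}` with (t1) a two-sided Serre presentation of `𝔞` («`∀ a ∈ 𝔞, ∃ d, c ≫ d = ι_x(a), d ≫ c = ι_{x″}(a)`» — hence `c` finite and surjective,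
★ `isFinite_left_of_serrePresentation`, ★ `surjective_left_of_serrePresentation` at a natural number `0 ≠ N ∈ 𝔞`), (t1′) `Ker c = 𝒜_x[𝔞]` on ALL `T`-points, and (t4)
`ι`-equivariance.  (1) ★ `exists_serrePresentation_of_ideal`: Serre data `(m, E, P, Q, N)` presenting `𝔟 = E𝒪ᵐ ≅ 𝔞⁻¹` with its row∕column laws.  (2) ★ (ν8k)
`exists_specialFibre_hom_reduction_ker_ringAction`: the reduction `c̄ : (𝒜_s)_{x̄} → (𝒜_s)_{x̄″}` of `c` is surjective, `ι`-equivariant, with `Ker c̄ = (𝒜_s)_{x̄}[𝔞]` on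
all `T`-points.  (3) ★ KER-EQ `exists_iso_serreTranslate_comp_eq_equivariant_of_comp_eq_one_iff_forall_mem` over `κ̄ = κ̄(v)` (algebraically closed, any
characteristic, no degree count): `c̄` factors through the Serre translate `ψ_P : (𝒜_s)_{x̄} → (𝒜_s)_{x̄} ⊗_𝒪 𝔟` by an EQUIVARIANT ISOMORPHISM `u : (𝒜_s)_{x̄} ⊗_𝒪 𝔟 ⥲ (𝒜_s)_{x̄″}`.
The output is PACKAGED as «presentation rows + `∃ u (_ : IsMonHom u) (_ : IsIso u), ∀ a, ι_{⊗}(a) ≫ u = u ≫ ι_{x̄″}(a)`» — the `pkg` binder of ★ (R9′) and the `hrec` binder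
of the L2 head, with the commutativity witness of the fibre a BINDER `hcomm` (a proof of a `Prop`; the consumer's own term, so that `serreTensor` agrees token for token)
and the two special points VARIABLES `p₁ p₂` under equations `red x = p₁`, `red x″ = p₂` (decided by `subst`; the consumer rewrites points inside the equations, never
inside fibre terms).

## Contents
* **`exists_fibreRecognitionPkg_of_cover`** — THE HEAD.

## References
* [SerreTate1968] J.-P. Serre, J. Tate, *Good reduction of abelian varieties*, Ann. of Math. 88 (1968), §1 (Lemma 2, Thm. 1).
* [Conrad2004GrossZagier] B. Conrad, *Gross–Zagier revisited*, MSRI Publ. 49 (2004), §7 (Thm. 7.5) — the Serre tensor construction and its recognition.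
* [MumfordAV1970] D. Mumford, *Abelian Varieties* (1970), §7 Thm. 4 (p. 72).
* [Shimura1998] G. Shimura, *Abelian varieties with complex multiplication and modular functions* (1998), §13.1 Thm. 1 (pp. 97–99), §18.6 (p. 127).
* [BoschLutkebohmertRaynaud1990] S. Bosch, W. Lütkebohmert, M. Raynaud, *Néron Models* (1990), §1.2 Prop. 8, §7.3 Prop. 6 (p. 180).
-/

set_option autoImplicit false

noncomputable section

set_option backward.isDefEq.respectTransparency false

open CategoryTheory CategoryTheory.Limits AlgebraicGeometry MonoidalCategory CartesianMonoidalCategory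
open scoped MonObj CategoryTheory.Obj NumberField
open Literature.AlgebraicGeometry.Motives
open IsDedekindDomain IsDedekindDomain.HeightOneSpectrum
open Literature.NumberTheory.EllipticCurves (genericFibre specGenericPoint)
open Literature.NumberTheory.DiophantineGeometry

namespace Literature.AlgebraicGeometry.AbelianSchemes

namespace AbelianSchemeOver

section Head

variable {K : Type} [Field K] [NumberField K] {v : HeightOneSpectrum (𝓞 K)} {Y : SchemeOver K}
  (𝓨 : IntegralModel (valuationSubringAtPrime K v) K Y) [IsProper 𝓨.total.hom]
  {𝒜 : AbelianSchemeOver 𝓨.total.left} {F : Type} [Field F] [NumberField F] (act : 𝒜.RingAction (𝓞 F)) [IsCommMonObj 𝒜.X]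
  (x x'' : AlgPoints Y (AlgebraicClosure (v.adicCompletion K)))

set_option maxHeartbeats 400000 in
/-- **THE FIBRE-LEVEL SERRE RECOGNITION PACKAGE OF THE SPECIAL FIBRES FROM A GENERIC SERRE COVER.**  `𝓨` a proper model at `v`, `𝒜 → 𝓨` an abelian scheme
(commutative) with an `𝓞 F`-action `act`, `x, x″ ∈ Y(Ω̄)`, `𝔞 ≠ 0` an ideal of `𝓞 F`, and UPSTAIRS a homomorphism `c : 𝒜_x → 𝒜_{x″}` with (t1) a two-sided Serre
presentation of `𝔞` through `c`, (t1′) `Ker c = 𝒜_x[𝔞]` on all `T`-points and (t4) `ι`-equivariance.  THEN for all special points `p₁ = red x`, `p₂ = red x″` there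
are Serre data `(m, E, P, Q, N)` of `𝔞⁻¹` (`N ≠ 0`, `EP = P`, `QE = Q`, `QP = N`, `PQ = N•E`, the entries of `Q` in the range of its first row, a column `P_c` with
`EP_c = P_c`, `P_cQ = c•E` for every such entry) and an `𝓞 F`-EQUIVARIANT ISOMORPHISM of group schemes `u : (𝒜_s)_{p₁} ⊗_E 𝔟 ⥲ (𝒜_s)_{p₂}` over `κ̄(v)` — the Serre
tensor of the FIBRE `(𝒜 ×_𝓨 𝓨_s) ×_{𝓨_s} p₁` for the commutativity witness `hcomm p₁`.  (★ `exists_serrePresentation_of_ideal`; `c` finite surjective from (t1); ★ (ν8k)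
reduction with kernel and equivariance; ★ rank-free recognition from the scheme-theoretic kernel over the algebraically closed field `κ̄(v)`.)
[cite: SerreTate1968, §1 Lemma 2, Thm 1] [cite: Conrad2004GrossZagier, §7 (Thm. 7.5)] [cite: MumfordAV1970, §7 Thm. 4 (p. 72)]
[cite: Shimura1998, §13.1 Thm. 1 (pp. 97–99); §18.6 proof of Thm. 18.6 (p. 127)] -/
theorem exists_fibreRecognitionPkg_of_cover
    (hcomm : ∀ p : AlgPoints 𝓨.reductionAt (geomResidueField v),
      IsCommMonObj ((𝒜.baseChange (pullback.fst 𝓨.total.hom (specResidueField v))).baseChange p.left).X)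
    {𝔞 : Ideal (𝓞 F)} (h𝔞 : 𝔞 ≠ ⊥)
    -- the upstairs cover between the fibres of `𝒜` at `x`, `x″`
    (c : ((𝒜.baseChange (𝓨.genericIso'.inv.left ≫ pullback.fst 𝓨.total.hom (specGenericPoint (valuationSubringAtPrime K v) K))).baseChange x.left).X ⟶
         ((𝒜.baseChange (𝓨.genericIso'.inv.left ≫ pullback.fst 𝓨.total.hom (specGenericPoint (valuationSubringAtPrime K v) K))).baseChange x''.left).X)
    [IsMonHom c]
    -- (t1) the two-sided Serre presentation of `𝔞` through `c`
    (h1 : ∀ a ∈ 𝔞, ∃ d : ((𝒜.baseChange (𝓨.genericIso'.inv.left ≫ pullback.fst 𝓨.total.hom (specGenericPoint (valuationSubringAtPrime K v) K))).baseChange x''.left).X ⟶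
          ((𝒜.baseChange (𝓨.genericIso'.inv.left ≫ pullback.fst 𝓨.total.hom (specGenericPoint (valuationSubringAtPrime K v) K))).baseChange x.left).X,
      c ≫ d = ((act.baseChange (𝓨.genericIso'.inv.left ≫ pullback.fst 𝓨.total.hom (specGenericPoint (valuationSubringAtPrime K v) K))).baseChange x.left).i a ∧
      d ≫ c = ((act.baseChange (𝓨.genericIso'.inv.left ≫ pullback.fst 𝓨.total.hom (specGenericPoint (valuationSubringAtPrime K v) K))).baseChange x''.left).i a)
    -- (t1′) the kernel of `c` is the `𝔞`-torsion, on ALL `T`-points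
    (hK : ∀ ⦃T : Over (Spec (.of (AlgebraicClosure (v.adicCompletion K))))⦄
        (t : T ⟶ ((𝒜.baseChange (𝓨.genericIso'.inv.left ≫ pullback.fst 𝓨.total.hom (specGenericPoint (valuationSubringAtPrime K v) K))).baseChange x.left).X),
      t ≫ c = 1 ↔ ∀ a ∈ 𝔞, t ≫ ((act.baseChange (𝓨.genericIso'.inv.left ≫ pullback.fst 𝓨.total.hom (specGenericPoint (valuationSubringAtPrime K v) K))).baseChange x.left).i a = 1)
    -- (t4) `ι`-equivariance
    (h4 : ∀ a : 𝓞 F,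
      ((act.baseChange (𝓨.genericIso'.inv.left ≫ pullback.fst 𝓨.total.hom (specGenericPoint (valuationSubringAtPrime K v) K))).baseChange x.left).i a ≫ c =
        c ≫ ((act.baseChange (𝓨.genericIso'.inv.left ≫ pullback.fst 𝓨.total.hom (specGenericPoint (valuationSubringAtPrime K v) K))).baseChange x''.left).i a)
    (p₁ p₂ : AlgPoints 𝓨.reductionAt (geomResidueField v)) (h₁ : 𝓨.geomReductionMap x = p₁) (h₂ : 𝓨.geomReductionMap x'' = p₂) :
    ∃ (m : ℕ) (E : Matrix (Fin m) (Fin m) (𝓞 F)) (hE : E * E = E) (P : Matrix (Fin m) (Fin 1) (𝓞 F)) (Q : Matrix (Fin 1) (Fin m) (𝓞 F)) (N : ℕ),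
      N ≠ 0 ∧ E * P = P ∧ Q * E = Q ∧ Q * P = Matrix.scalar (Fin 1) (N : 𝓞 F) ∧ P * Q = Matrix.scalar (Fin m) (N : 𝓞 F) * E ∧
      (∀ j k', Q j k' ∈ Set.range fun k' => Q 0 k') ∧
      (∀ c ∈ Set.range (fun k' => Q 0 k'), ∃ Pc : Matrix (Fin m) (Fin 1) (𝓞 F), E * Pc = Pc ∧ Pc * Q = c • E) ∧
      ∃ (u : (@serreTensor _ ((𝒜.baseChange (pullback.fst 𝓨.total.hom (specResidueField v))).baseChange p₁.left) (𝓞 F) _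
              ((act.baseChange (pullback.fst 𝓨.total.hom (specResidueField v))).baseChange p₁.left) (hcomm p₁) m E hE).X ⟶
            ((𝒜.baseChange (pullback.fst 𝓨.total.hom (specResidueField v))).baseChange p₂.left).X)
        (_ : IsMonHom u) (_ : IsIso u),
        ∀ a : 𝓞 F, (@serreAction _ ((𝒜.baseChange (pullback.fst 𝓨.total.hom (specResidueField v))).baseChange p₁.left) (𝓞 F) _
              ((act.baseChange (pullback.fst 𝓨.total.hom (specResidueField v))).baseChange p₁.left) (hcomm p₁) m E hE).i a ≫ u =
          u ≫ ((act.baseChange (pullback.fst 𝓨.total.hom (specResidueField v))).baseChange p₂.left).i a := by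
  -- the special points ARE the reductions of `x`, `x″` (decided on the point variables, never inside fibre terms)
  subst h₁ h₂
  -- (1) Serre data `(m, E, P, Q, N)` presenting `𝔟 = E𝒪ᵐ ≅ 𝔞⁻¹`, with the row∕column laws of the package
  obtain ⟨m, E, hE, P, Q, N, hN, hP, hQ, hQP, hPQ, hspan, hQr, hPc⟩ :=
    Literature.NumberTheory.NumberFields.SerrePresentation.exists_serrePresentation_of_ideal 𝔞 h𝔞
  -- `N ∈ 𝔞` (`Q·P = N`), so (t1) at `a := N` makes `c` finite and surjective
  have hN𝔞 : ((N : ℕ) : 𝓞 F) ∈ 𝔞 := natCast_mem_of_quasiInverse P Q hQP hspan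
  have hfin : IsFinite c.left :=
    isFinite_left_of_serrePresentation
      ((act.baseChange (𝓨.genericIso'.inv.left ≫ pullback.fst 𝓨.total.hom (specGenericPoint (valuationSubringAtPrime K v) K))).baseChange x.left)
      ((act.baseChange (𝓨.genericIso'.inv.left ≫ pullback.fst 𝓨.total.hom (specGenericPoint (valuationSubringAtPrime K v) K))).baseChange x''.left)
      c h1 hN hN𝔞
  have hsurj : Surjective c.left :=
    surjective_left_of_serrePresentation
      ((act.baseChange (𝓨.genericIso'.inv.left ≫ pullback.fst 𝓨.total.hom (specGenericPoint (valuationSubringAtPrime K v) K))).baseChange x''.left)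
      ((act.baseChange (𝓨.genericIso'.inv.left ≫ pullback.fst 𝓨.total.hom (specGenericPoint (valuationSubringAtPrime K v) K))).baseChange x.left)
      c h1 hN hN𝔞
  -- (2) ★ (ν8k) ED. 2: the reduction `c̄` of `c`, surjective (i), `ι`-equivariant (ii-ι), with `Ker c̄ = (𝒜_s)_{x̄}[𝔞]` on all `T`-points (v′)
  obtain ⟨cbar, hcbmon, hi, -, hiiι, -, -, hv⟩ :=
    exists_specialFibre_hom_reduction_ker_ringAction 𝓨 𝒜 𝒜 x x'' c act act E hE P Q hN hP hQ hQP hPQ hspan hK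
  haveI := hcbmon
  haveI : Surjective cbar.left := ⟨(hi hfin hsurj).2⟩
  haveI : IsCommMonObj ((𝒜.baseChange (pullback.fst 𝓨.total.hom (specResidueField v))).baseChange (𝓨.geomReductionMap x).left).X :=
    hcomm (𝓨.geomReductionMap x)
  -- (3) ★ KER-EQ §3 over the algebraically closed field `κ̄(v)`: `c̄ = ψ_P ≫ u` for an equivariant ISOMORPHISM `u`
  obtain ⟨u, -, humon, hequiv, -⟩ :=
    exists_iso_serreTranslate_comp_eq_equivariant_of_comp_eq_one_iff_forall_mem
      ((act.baseChange (pullback.fst 𝓨.total.hom (specResidueField v))).baseChange (𝓨.geomReductionMap x).left) E hE P Q cbar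
      ((act.baseChange (pullback.fst 𝓨.total.hom (specResidueField v))).baseChange (𝓨.geomReductionMap x'').left)
      hN hP hQ hQP hPQ hspan (fun a => hiiι a (h4 a)) (hv hfin hsurj)
  exact ⟨m, E, hE, P, Q, N, hN, hP, hQ, hQP, hPQ, hQr, hPc, u.hom, humon, inferInstance, hequiv⟩

end Head

end AbelianSchemeOver

end Literature.AlgebraicGeometry.AbelianSchemes

end
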